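import Literature.Computability.QuantumComplexity.PermanentSearchReplay
import Literature.Computability.QuantumComplexity.PermanentSearchWords
import Literature.Computability.QuantumComplexity.PermanentSearchArith
import Literature.Computability.Complexity.RatBricks
import Literature.Computability.Complexity.StackOracle
import Literature.Computability.Complexity.ListBricks
import HarnessLib

/-!
# One round of the AA13 permanent search as an `FP` brick: the grid of `3g + 1` queries replayed

Aaronson–Arkhipov, *The computational complexity of linear optics*, Theory of Computing 9 (2013),
proof of Thm. 4.3, eqs. (4.9)–(4.15) (p. 177): one round of the search for `r* = Per(X)/Per(Y)`
evaluates the oracle at the `L + 1 = 3g + 1` grid points of `[r − β', r + β']` and keeps the point of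
least (normalised) value. In the tree this is `PerSearch.searchRound` (`PermanentSearch.lean`); its
replay against a transcript has the closed form `PerSearch.replay_searchRound`
(`PermanentSearchReplay.lean`): all `3g + 1` answers present — the `argmin` of the grid values read off
them — or the pending grid query number `|as|`. This file realises that replay on string records, the
unit from which the machine of `PerSearch.randSearchAlg_isPolyTime` is assembled:

* record formats: the remaining transcript `ansEnc as = ⟨1^{|as|}, encList as⟩` (consumed from the
  front: `ansHdF`, `ansTlF`), the search state `stEnc (t, r, v) = ⟨bin t, ⟨qEnc r, bin v⟩⟩`, the level
  data `fdEnc m w P_Y = ⟨w, ⟨1^{m+1}, ⟨bin P_Y, bin (m+1)!⟩⟩⟩` (`w` the row-major word of the `0/1`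
  matrix `X'` of the level), the round context `ctxEnc` and the grid record `gRec` (context, next grid
  index, status, transcript, current best point);
* `ptF G` — the code `qEnc` of the `i`-th grid point (`gridZF`/`gridMF` of `PermanentSearchArith.lean`
  reduced by `qnormF`; `ptF_gRec`), and `queryF G c q₀` — the relabelled query at that point
  (`smatC` of `PermanentSearchWords.lean`, `querF`; `queryF_gRec`: it is the query of the randomised
  maker `randMaker G c q₀ u` at the grid point `roundPt`);
* `gridStep G c q₀` — one grid index: idle if not running; pending (status `1 q`) if the transcript
  is exhausted; else consume one answer and update the running `argmin` (`keyLtF`); its iterates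
  `gridStep^[j]` follow the online fold `gfold` (`iterate_gridStep_gRec`) or stop pending
  (`iterate_gridStep_pending`), and `gfold` from index `0` is the `argminBy keyW` of the `zipWith` of
  `replay_searchRound` (`gfold_eq_argminBy`);
* **`roundF G c q₀`** — one search round on the state `⟨S, ⟨AS, ⟨FD, ST⟩⟩⟩` of the rounds loop (idle
  unless running; `v = 0` keeps the point; else `gridStep^[3G+1]` and the new point), in `FP`, with
  **`roundF_running`**: from `stateEnc [] as m w P_Y st` it returns `stateEnc [] as' m w P_Y st'` when
  `replay (searchRound (randMaker G c q₀ u) G (m+1) (wmat (m+1) w) P_Y st) as = inr (st', as')`, and the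
  pending state `stateEnc (1 q) [] m w P_Y st` when it is `inl q`; records that are not running are
  fixed (`roundF_idle`).

## References

* S. Aaronson, A. Arkhipov, *The computational complexity of linear optics*, Theory of Computing 9
  (2013), proof of Thm. 4.3, eqs. (4.9)–(4.15) (p. 177); Thm. 1.1 (p. 149).
* S. Arora, B. Barak, *Computational Complexity: A Modern Approach*, CUP 2009, §3.4 (oracle
  machines: replaying the answers received), §1.3 (composition, bounded loops).
-/

noncomputable section

namespace Literature.Computability.QuantumComplexity

open _root_.Computability Complexity Complexity.Brick Complexity.Plumb Complexity.OracleComp Matrix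
  Literature.Computability.AlgebraicComplexity Polynomial

namespace PerSearch

/-! ### Record formats -/

/-- **The remaining transcript** as the machine holds it: `⟨1^{|as|}, encList as⟩` (one count bit per
answer left, the answers as nested pairs; `OracleComp.rawAnswers` reads it back). [cite: AroraBarak2009, §3.4] -/
def ansEnc (as : List (List Bool)) : List Bool := boolPair (ones as.length) (encList as)

/-- `encList` is the right fold of `boolPair`. [folklore] -/
theorem encList_eq_foldr (as : List (List Bool)) : encList as = as.foldr (fun a acc => boolPair a acc) [] := by
  induction as with
  | nil => rfl
  | cons a as ih => rw [encList_cons, List.foldr_cons, ih]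

/-- The transcript code represents the transcript. [folklore] -/
theorem rawAnswers_ansEnc (as : List (List Bool)) : rawAnswers (ones as.length) (encList as) = as := by
  have := rawAnswers_listBool as
  rwa [OracleCompose.unaryEncodeNat_eq_replicate, ← encList_eq_foldr] at this

/-- **The search state** `(t, r, v)`: `⟨bin t, ⟨qEnc r, bin v⟩⟩`. [cite: AaronsonArkhipovToC2013, proof of Thm. 4.3 (p. 177)] -/
def stEnc (st : ℕ × ℚ × ℕ) : List Bool := boolPair (encodeNat st.1) (boolPair (qEnc st.2.1) (encodeNat st.2.2))

/-- **A candidate** (point, value): `⟨qEnc pt, bin w⟩`. [folklore] -/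
def bEnc (b : ℚ × ℕ) : List Bool := boolPair (qEnc b.1) (encodeNat b.2)

/-- **The level data** of a level of dimension `m + 1`: the row-major word `w` of its `0/1` matrix, the
dimension in unary, `P_Y` and `(m+1)!` in binary. [folklore] -/
def fdEnc (m : ℕ) (w : List Bool) (PY : ℕ) : List Bool :=
  boolPair w (boolPair (ones (m + 1)) (boolPair (encodeNat PY) (encodeNat (m + 1).factorial)))

/-- **The round context**: machine input, level data, search state. [folklore] -/
def ctxEnc (inp : List Bool) (m : ℕ) (w : List Bool) (PY : ℕ) (st : ℕ × ℚ × ℕ) : List Bool :=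
  boolPair inp (boolPair (fdEnc m w PY) (stEnc st))

/-- **The grid record**: context, next grid index `bin i`, status `S`, transcript, current best. [folklore] -/
def gRec (cx : List Bool) (i : ℕ) (S : List Bool) (as : List (List Bool)) (b : ℚ × ℕ) : List Bool :=
  boolPair cx (boolPair (encodeNat i) (boolPair S (boolPair (ansEnc as) (bEnc b))))

/-- **The state of the rounds loop**: status, transcript, level data, search state. [folklore] -/
def stateEnc (S : List Bool) (as : List (List Bool)) (m : ℕ) (w : List Bool) (PY : ℕ) (st : ℕ × ℚ × ℕ) : List Bool :=
  boolPair S (boolPair (ansEnc as) (boolPair (fdEnc m w PY) (stEnc st)))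

/-! ### Consuming the transcript -/

/-- On `ansEnc as`: the first answer (`ε` if none). [folklore] -/
def ansHdF : List Bool → List Bool := fstF ∘ sndF

/-- Value of `ansHdF`. [folklore] -/
@[simp] theorem ansHdF_ansEnc (a : List Bool) (as : List (List Bool)) : ansHdF (ansEnc (a :: as)) = a := by
  simp [ansHdF, ansEnc, encList_cons]

/-- `ansHdF ∈ FP`. [cite: AroraBarak2009, §1.3] -/
theorem ansHdF_mem_FP : ansHdF ∈ FP := comp_mem_FP fstF_mem_FP sndF_mem_FP

/-- On `ansEnc as`: the transcript without its first answer. [folklore] -/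
def ansTlF : List Bool → List Bool := fanoutFn (dropFn ∘ fanoutFn (fun _ => [true]) fstF) (sndF ∘ sndF)

/-- Value of `ansTlF`. [folklore] -/
@[simp] theorem ansTlF_ansEnc (a : List Bool) (as : List (List Bool)) : ansTlF (ansEnc (a :: as)) = ansEnc as := by
  simp [ansTlF, ansEnc, encList_cons, ones, List.replicate_succ]

/-- `ansTlF ∈ FP`. [cite: AroraBarak2009, §1.3] -/
theorem ansTlF_mem_FP : ansTlF ∈ FP :=
  fanoutFn_mem_FP (comp_mem_FP dropFn_mem_FP (fanoutFn_mem_FP (const_mem_FP _) fstF_mem_FP)) (comp_mem_FP sndF_mem_FP sndF_mem_FP)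

/-- The count field of `ansEnc` is empty iff the transcript is. [folklore] -/
@[simp] theorem isNilFn_fstF_ansEnc (as : List (List Bool)) : isNilFn (fstF (ansEnc as)) = [decide (as = [])] := by
  cases as <;> simp [ansEnc, isNilFn, ones, List.replicate_succ]

/-! ### Projections of the grid record -/

/-- The context field of a grid record. [folklore] -/
def zCtx : List Bool → List Bool := nthF 0
/-- The grid index field. [folklore] -/
def zI : List Bool → List Bool := nthF 1
/-- The status field. [folklore] -/
def zS : List Bool → List Bool := nthF 2
/-- The transcript field. [folklore] -/
def zAS : List Bool → List Bool := nthF 3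
/-- The best-candidate field. [folklore] -/
def zB : List Bool → List Bool := sndPow 3
/-- The machine input, from the context. [folklore] -/
def cInp : List Bool → List Bool := nthF 0 ∘ zCtx
/-- The word of the level's matrix. [folklore] -/
def cW : List Bool → List Bool := nthF 0 ∘ nthF 1 ∘ zCtx
/-- The dimension in unary. [folklore] -/
def cK : List Bool → List Bool := nthF 1 ∘ nthF 1 ∘ zCtx
/-- `bin P_Y`. [folklore] -/
def cP : List Bool → List Bool := nthF 2 ∘ nthF 1 ∘ zCtx
/-- `bin (m+1)!`. [folklore] -/
def cF : List Bool → List Bool := sndPow 2 ∘ nthF 1 ∘ zCtx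
/-- `bin t`. [folklore] -/
def cT : List Bool → List Bool := nthF 0 ∘ sndPow 1 ∘ zCtx
/-- `qEnc r`. [folklore] -/
def cR : List Bool → List Bool := nthF 1 ∘ sndPow 1 ∘ zCtx
/-- `bin v`. [folklore] -/
def cV : List Bool → List Bool := sndPow 1 ∘ sndPow 1 ∘ zCtx

section Projections

variable (inp : List Bool) (m : ℕ) (w : List Bool) (PY : ℕ) (st : ℕ × ℚ × ℕ) (i : ℕ) (S : List Bool)
  (as : List (List Bool)) (b : ℚ × ℕ)

/-- Value of the projection `zCtx` on a grid record. [folklore] -/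
@[simp] theorem zCtx_gRec (cx : List Bool) : zCtx (gRec cx i S as b) = cx := by simp [zCtx, gRec]
/-- Value of the projection `zI` on a grid record. [folklore] -/
@[simp] theorem zI_gRec (cx : List Bool) : zI (gRec cx i S as b) = encodeNat i := by simp [zI, gRec, nthF]
/-- Value of the projection `zS` on a grid record. [folklore] -/
@[simp] theorem zS_gRec (cx : List Bool) : zS (gRec cx i S as b) = S := by simp [zS, gRec, nthF]
/-- Value of the projection `zAS` on a grid record. [folklore] -/
@[simp] theorem zAS_gRec (cx : List Bool) : zAS (gRec cx i S as b) = ansEnc as := by simp [zAS, gRec, nthF]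
/-- Value of the projection `zB` on a grid record. [folklore] -/
@[simp] theorem zB_gRec (cx : List Bool) : zB (gRec cx i S as b) = bEnc b := by simp [zB, gRec, sndPow]
/-- Value of the projection `cInp` on a grid record. [folklore] -/
@[simp] theorem cInp_gRec : cInp (gRec (ctxEnc inp m w PY st) i S as b) = inp := by simp [cInp, ctxEnc]
/-- Value of the projection `cW` on a grid record. [folklore] -/
@[simp] theorem cW_gRec : cW (gRec (ctxEnc inp m w PY st) i S as b) = w := by simp [cW, ctxEnc, fdEnc, nthF]
/-- Value of the projection `cK` on a grid record. [folklore] -/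
@[simp] theorem cK_gRec : cK (gRec (ctxEnc inp m w PY st) i S as b) = ones (m + 1) := by simp [cK, ctxEnc, fdEnc, nthF]
/-- Value of the projection `cP` on a grid record. [folklore] -/
@[simp] theorem cP_gRec : cP (gRec (ctxEnc inp m w PY st) i S as b) = encodeNat PY := by simp [cP, ctxEnc, fdEnc, nthF]
/-- Value of the projection `cF` on a grid record. [folklore] -/
@[simp] theorem cF_gRec : cF (gRec (ctxEnc inp m w PY st) i S as b) = encodeNat (m + 1).factorial := by
  simp [cF, ctxEnc, fdEnc, nthF, sndPow]
/-- Value of the projection `cT` on a grid record. [folklore] -/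
@[simp] theorem cT_gRec : cT (gRec (ctxEnc inp m w PY st) i S as b) = encodeNat st.1 := by simp [cT, ctxEnc, stEnc, nthF, sndPow]
/-- Value of the projection `cR` on a grid record. [folklore] -/
@[simp] theorem cR_gRec : cR (gRec (ctxEnc inp m w PY st) i S as b) = qEnc st.2.1 := by simp [cR, ctxEnc, stEnc, nthF, sndPow]
/-- Value of the projection `cV` on a grid record. [folklore] -/
@[simp] theorem cV_gRec : cV (gRec (ctxEnc inp m w PY st) i S as b) = encodeNat st.2.2 := by simp [cV, ctxEnc, stEnc, sndPow]

end Projections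

/-- All projections are in `FP`. [cite: AroraBarak2009, §1.3] -/
theorem proj_mem_FP : zCtx ∈ FP ∧ zI ∈ FP ∧ zS ∈ FP ∧ zAS ∈ FP ∧ zB ∈ FP ∧ cInp ∈ FP ∧ cW ∈ FP ∧ cK ∈ FP ∧ cP ∈ FP ∧
    cF ∈ FP ∧ cT ∈ FP ∧ cR ∈ FP ∧ cV ∈ FP :=
  ⟨nthF_mem_FP 0, nthF_mem_FP 1, nthF_mem_FP 2, nthF_mem_FP 3, sndPow_mem_FP 3,
    comp_mem_FP (nthF_mem_FP 0) (nthF_mem_FP 0),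
    comp_mem_FP (nthF_mem_FP 0) (comp_mem_FP (nthF_mem_FP 1) (nthF_mem_FP 0)),
    comp_mem_FP (nthF_mem_FP 1) (comp_mem_FP (nthF_mem_FP 1) (nthF_mem_FP 0)),
    comp_mem_FP (nthF_mem_FP 2) (comp_mem_FP (nthF_mem_FP 1) (nthF_mem_FP 0)),
    comp_mem_FP (sndPow_mem_FP 2) (comp_mem_FP (nthF_mem_FP 1) (nthF_mem_FP 0)),
    comp_mem_FP (nthF_mem_FP 0) (comp_mem_FP (sndPow_mem_FP 1) (nthF_mem_FP 0)),
    comp_mem_FP (nthF_mem_FP 1) (comp_mem_FP (sndPow_mem_FP 1) (nthF_mem_FP 0)),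
    comp_mem_FP (sndPow_mem_FP 1) (comp_mem_FP (sndPow_mem_FP 1) (nthF_mem_FP 0))⟩

/-! ### The grid point and its query -/

/-- **The code of the `i`-th grid point** on a grid record: numerator `gridZF` over denominator
`gridMF`, reduced to lowest terms (`qnormF`). [cite: AaronsonArkhipovToC2013, proof of Thm. 4.3, eq. (4.9) (p. 177)] -/
def ptF (G : ℕ) : List Bool → List Bool :=
  qnormF ∘ fanoutFn
    (gridZF G ∘ fanoutFn (fstF ∘ cR) (fanoutFn cP (fanoutFn (halfKF G ∘ fanoutFn cV (fanoutFn (sndF ∘ cR) cF)) zI)))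
    (gridMF G ∘ fanoutFn (sndF ∘ cR) cP)

/-- `ptF G ∈ FP`. [cite: AroraBarak2009, §1.3] -/
theorem ptF_mem_FP (G : ℕ) : ptF G ∈ FP := by
  obtain ⟨_, hI, _, _, _, _, _, _, hP, hF, _, hR, hV⟩ := proj_mem_FP
  exact comp_mem_FP qnormF_mem_FP (fanoutFn_mem_FP
    (comp_mem_FP (gridZF_mem_FP G) (fanoutFn_mem_FP (comp_mem_FP fstF_mem_FP hR) (fanoutFn_mem_FP hP
      (fanoutFn_mem_FP (comp_mem_FP (halfKF_mem_FP G) (fanoutFn_mem_FP hV (fanoutFn_mem_FP (comp_mem_FP sndF_mem_FP hR) hF))) hI))))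
    (comp_mem_FP (gridMF_mem_FP G) (fanoutFn_mem_FP (comp_mem_FP sndF_mem_FP hR) hP)))

/-- **Value of the grid point brick**: the code of the grid point `roundPt G m P_Y st i` (for `P_Y > 0`). [cite: AaronsonArkhipovToC2013, proof of Thm. 4.3, eq. (4.9) (p. 177)] -/
theorem ptF_gRec (G : ℕ) (inp : List Bool) (m : ℕ) (w : List Bool) {PY : ℕ} (hPY : 0 < PY) (st : ℕ × ℚ × ℕ) (i : ℕ)
    (S : List Bool) (as : List (List Bool)) (b : ℚ × ℕ) :
    ptF G (gRec (ctxEnc inp m w PY st) i S as b) = qEnc (roundPt G m PY st i) := by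
  rw [roundPt, gridPt_eq_div G m hPY]
  simp only [ptF, Function.comp_apply, fanoutFn_apply, cR_gRec, cP_gRec, cV_gRec, cF_gRec, zI_gRec, fstF_qEnc, sndF_qEnc,
    halfKF_eq_halfK, gridZF_apply, ival_dpEnc, bitsToNat_encodeNat, gridMF_apply]
  rw [qnormF_dpEnc _ (gridM_pos st.2.1.den_pos hPY)]

/-- The decorated query `u` inside the machine input of the context. [folklore] -/
def cU : List Bool → List Bool := fstF ∘ cInp

/-- Value of the projection `cU` on a grid record. [folklore] -/
@[simp] theorem cU_gRec (u A : List Bool) (m : ℕ) (w : List Bool) (PY : ℕ) (st : ℕ × ℚ × ℕ) (i : ℕ) (S : List Bool)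
    (as : List (List Bool)) (b : ℚ × ℕ) : cU (gRec (ctxEnc (boolPair u A) m w PY st) i S as b) = u := by
  simp [cU]

/-- `cU ∈ FP`. [cite: AroraBarak2009, §1.3] -/
theorem cU_mem_FP : cU ∈ FP := comp_mem_FP fstF_mem_FP proj_mem_FP.2.2.2.2.2.1

/-- On a grid record: **the argument record of `querF`** — `⟨⟨x, r⟩, ⟨matrix code, block index⟩⟩` with
the outer input `x = inX u`, the coins `r = inR u`, the code `smatC` of the scaled matrix at the grid
point and the block index of the site `(m+1, 2, t, i)` in sub-run `inI u`. [cite: AaronsonArkhipovToC2013, proof of Thm. 4.3 (p. 177) with Thm. 1.1 (p. 149)] -/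
def qArgF (G : ℕ) (q₀ : Polynomial ℕ) : List Bool → List Bool :=
  fanoutFn (fanoutFn (fstF ∘ fstF ∘ cU) (sndF ∘ fstF ∘ cU))
    (fanoutFn (smatC ∘ fanoutFn (fanoutFn cW cK) (ptF G))
      (blockIdxF G q₀ ∘ fanoutFn (fstF ∘ fstF ∘ cU)
        (fanoutFn (lenBinF ∘ fstF ∘ fstF ∘ sndF ∘ cU)
          (fanoutFn (lenBinF ∘ cK) (fanoutFn (fun _ => encodeNat 2) (fanoutFn cT zI))))))

/-- `qArgF G q₀ ∈ FP`. [cite: AroraBarak2009, §1.3] -/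
theorem qArgF_mem_FP (G : ℕ) (q₀ : Polynomial ℕ) : qArgF G q₀ ∈ FP := by
  obtain ⟨_, hI, _, _, _, _, hW, hK, _, _, hT, _, _⟩ := proj_mem_FP
  have hU := cU_mem_FP
  exact fanoutFn_mem_FP (fanoutFn_mem_FP (comp_mem_FP fstF_mem_FP (comp_mem_FP fstF_mem_FP hU))
      (comp_mem_FP sndF_mem_FP (comp_mem_FP fstF_mem_FP hU)))
    (fanoutFn_mem_FP (comp_mem_FP smatC_mem_FP (fanoutFn_mem_FP (fanoutFn_mem_FP hW hK) (ptF_mem_FP G)))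
      (comp_mem_FP (blockIdxF_mem_FP G q₀) (fanoutFn_mem_FP (comp_mem_FP fstF_mem_FP (comp_mem_FP fstF_mem_FP hU))
        (fanoutFn_mem_FP (comp_mem_FP lenBinF_mem_FP (comp_mem_FP fstF_mem_FP (comp_mem_FP fstF_mem_FP (comp_mem_FP sndF_mem_FP hU))))
          (fanoutFn_mem_FP (comp_mem_FP lenBinF_mem_FP hK) (fanoutFn_mem_FP (const_mem_FP _) (fanoutFn_mem_FP hT hI)))))))

/-- **Value of the argument record.** [folklore] -/
theorem qArgF_gRec (G : ℕ) (q₀ : Polynomial ℕ) (u A : List Bool) (m : ℕ) {w : List Bool} (hw : w.length = (m + 1) * (m + 1))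
    {PY : ℕ} (hPY : 0 < PY) (st : ℕ × ℚ × ℕ) (i : ℕ) (S : List Bool) (as : List (List Bool)) (b : ℚ × ℕ) :
    qArgF G q₀ (gRec (ctxEnc (boolPair u A) m w PY st) i S as b) =
      boolPair (boolPair (inX u) (inR u))
        (boolPair (encodingIntMatrix.encode ⟨m + 1, fun a b => scaledMatrix (wmat (m + 1) w) (roundPt G m PY st i) a b⟩)
          (encodeNat (inI u * (NSp G q₀).eval (inX u).length + siteIdx G q₀ (inX u).length (m + 1, 2, st.1, i)))) := by
  have hpt := ptF_gRec G (boolPair u A) m w hPY st i S as b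
  have hsm : smatC (boolPair (boolPair w (ones (m + 1))) (qEnc (roundPt G m PY st i))) =
      encodingIntMatrix.encode ⟨m + 1, fun a b => scaledMatrix (wmat (m + 1) w) (roundPt G m PY st i) a b⟩ := by
    rw [qEnc, smatC_apply w hw (Nat.succ_pos m), ival_dpEnc, bitsToNat_encodeNat, scaledMatrix_wmat]
  have hblk := blockIdxF_apply G q₀ (inX u) (inI u) (m + 1, 2, st.1, i)
  simp only [qArgF, fanoutFn_apply, Function.comp_apply, cU_gRec, cW_gRec, cK_gRec, cT_gRec, zI_gRec, hpt, hsm, lenBinF_apply]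
  rw [show (ones (m + 1)).length = m + 1 by simp [ones]]
  show boolPair (boolPair (inX u) (inR u)) (boolPair _ (blockIdxF G q₀ (boolPair (inX u) (boolPair (encodeNat (inI u))
    (boolPair (encodeNat (m + 1)) (boolPair (encodeNat 2) (boolPair (encodeNat st.1) (encodeNat i)))))))) = _
  rw [hblk]

/-- **The query at the `i`-th grid point** on a grid record: coins spliced in by `querF`. [cite: AaronsonArkhipovToC2013, proof of Thm. 4.3 (p. 177) with Thm. 1.1 (p. 149)] -/
def queryF (G : ℕ) (c q₀ : Polynomial ℕ) : List Bool → List Bool := querF G c q₀ ∘ qArgF G q₀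

/-- `queryF G c q₀ ∈ FP`. [cite: AroraBarak2009, §1.3] -/
theorem queryF_mem_FP (G : ℕ) (c q₀ : Polynomial ℕ) : queryF G c q₀ ∈ FP := comp_mem_FP (querF_mem_FP G c q₀) (qArgF_mem_FP G q₀)

/-- **Value of the query brick** on a grid record whose machine input is `⟨u, A⟩`: the query of the
randomised maker `randMaker G c q₀ u` (`PermanentSearchReplay.lean`) at the site `(m+1, 2, t, i)` for
the scaled matrix at the grid point `roundPt G m P_Y st i`. [cite: AaronsonArkhipovToC2013, proof of Thm. 4.3 (p. 177) with Thm. 1.1 (p. 149)] -/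
theorem queryF_gRec (G : ℕ) (c q₀ : Polynomial ℕ) (u A : List Bool) (m : ℕ) {w : List Bool} (hw : w.length = (m + 1) * (m + 1))
    {PY : ℕ} (hPY : 0 < PY) (st : ℕ × ℚ × ℕ) (i : ℕ) (S : List Bool) (as : List (List Bool)) (b : ℚ × ℕ) :
    queryF G c q₀ (gRec (ctxEnc (boolPair u A) m w PY st) i S as b) =
      randMaker G c q₀ u (m + 1, 2, st.1, i) ⟨m + 1, fun a b => scaledMatrix (wmat (m + 1) w) (roundPt G m PY st i) a b⟩ := by
  rw [queryF, Function.comp_apply, qArgF_gRec G q₀ u A m hw hPY, querF_eq_coinMap]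
  rfl

/-! ### One grid index -/

/-- The code `qEnc 0 = ⟨⟨ε, ε⟩, 1⟩` paired with `bin 0`: the junk best candidate before index `0`. [folklore] -/
def junkB : List Bool := bEnc (0, 0)

/-- On a grid record with an answer available: **the candidate of the current index** `⟨ptF, bin (decodeNat a)⟩`. [folklore] -/
def candF (G : ℕ) : List Bool → List Bool := fanoutFn (ptF G) (canonF ∘ ansHdF ∘ zAS)

/-- `candF G ∈ FP`. [cite: AroraBarak2009, §1.3] -/
theorem candF_mem_FP (G : ℕ) : candF G ∈ FP :=
  fanoutFn_mem_FP (ptF_mem_FP G) (comp_mem_FP canonF_mem_FP (comp_mem_FP ansHdF_mem_FP proj_mem_FP.2.2.2.1))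

/-- The selection of the running `argmin`: the new candidate at index `0`, else the new candidate iff its
key is smaller (`keyLtF`), else the old best. [cite: AaronsonArkhipovToC2013, proof of Thm. 4.3, eq. (4.15) (p. 177)] -/
def newBestF (G : ℕ) : List Bool → List Bool :=
  iteFn (isNilFn ∘ zI) (candF G)
    (iteFn (keyLtF ∘ fanoutFn (fanoutFn (sndF ∘ candF G) (sndF ∘ fstF ∘ candF G)) (fanoutFn (sndF ∘ zB) (sndF ∘ fstF ∘ zB)))
      (candF G) zB)

/-- `newBestF G ∈ FP`. [cite: AroraBarak2009, §1.3] -/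
theorem newBestF_mem_FP (G : ℕ) : newBestF G ∈ FP := by
  have hB : zB ∈ FP := proj_mem_FP.2.2.2.2.1
  have hC := candF_mem_FP G
  exact iteFn_mem_FP (comp_mem_FP isNilFn_mem_FP proj_mem_FP.2.1) hC
    (iteFn_mem_FP (comp_mem_FP keyLtF_mem_FP (fanoutFn_mem_FP
      (fanoutFn_mem_FP (comp_mem_FP sndF_mem_FP hC) (comp_mem_FP sndF_mem_FP (comp_mem_FP fstF_mem_FP hC)))
      (fanoutFn_mem_FP (comp_mem_FP sndF_mem_FP hB) (comp_mem_FP sndF_mem_FP (comp_mem_FP fstF_mem_FP hB))))) hC hB)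

/-- The selection function of `argminBy keyW`. [folklore] -/
def sel (acc q : ℚ × ℕ) : ℚ × ℕ := if keyW q < keyW acc then q else acc

/-- **Consume one answer**: bump the index, keep running, drop the answer, update the best. [folklore] -/
def consumeF (G : ℕ) : List Bool → List Bool :=
  fanoutFn zCtx (fanoutFn (addFn ∘ fanoutFn zI fun _ => [true]) (fanoutFn (fun _ => []) (fanoutFn (ansTlF ∘ zAS) (newBestF G))))

/-- `consumeF G ∈ FP`. [cite: AroraBarak2009, §1.3] -/
theorem consumeF_mem_FP (G : ℕ) : consumeF G ∈ FP :=
  fanoutFn_mem_FP proj_mem_FP.1 (fanoutFn_mem_FP (comp_mem_FP addFn_mem_FP (fanoutFn_mem_FP proj_mem_FP.2.1 (const_mem_FP _)))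
    (fanoutFn_mem_FP (const_mem_FP _) (fanoutFn_mem_FP (comp_mem_FP ansTlF_mem_FP proj_mem_FP.2.2.2.1) (newBestF_mem_FP G))))

/-- **Stop pending**: status `1 q` with the query `q` of the current index, everything else kept. [folklore] -/
def pendF (G : ℕ) (c q₀ : Polynomial ℕ) : List Bool → List Bool :=
  fanoutFn zCtx (fanoutFn zI (fanoutFn (List.cons true ∘ queryF G c q₀) (fanoutFn zAS zB)))

/-- `pendF G c q₀ ∈ FP`. [cite: AroraBarak2009, §1.3] -/
theorem pendF_mem_FP (G : ℕ) (c q₀ : Polynomial ℕ) : pendF G c q₀ ∈ FP :=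
  fanoutFn_mem_FP proj_mem_FP.1 (fanoutFn_mem_FP proj_mem_FP.2.1 (fanoutFn_mem_FP (comp_mem_FP (cons_mem_FP true) (queryF_mem_FP G c q₀))
    (fanoutFn_mem_FP proj_mem_FP.2.2.2.1 proj_mem_FP.2.2.2.2.1)))

/-- **One grid index**: idle unless running (status `ε`); pending if no answer is left; else consume. [cite: AaronsonArkhipovToC2013, proof of Thm. 4.3 (p. 177)] -/
def gridStep (G : ℕ) (c q₀ : Polynomial ℕ) : List Bool → List Bool :=
  iteFn (isNilFn ∘ zS) (iteFn (isNilFn ∘ fstF ∘ zAS) (pendF G c q₀) (consumeF G)) id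

/-- `gridStep G c q₀ ∈ FP`. [cite: AroraBarak2009, §1.3] -/
theorem gridStep_mem_FP (G : ℕ) (c q₀ : Polynomial ℕ) : gridStep G c q₀ ∈ FP :=
  iteFn_mem_FP (comp_mem_FP isNilFn_mem_FP proj_mem_FP.2.2.1)
    (iteFn_mem_FP (comp_mem_FP isNilFn_mem_FP (comp_mem_FP fstF_mem_FP proj_mem_FP.2.2.2.1)) (pendF_mem_FP G c q₀) (consumeF_mem_FP G))
    OracleCompose.id_mem_FP

/-- Constantly many grid indices are in `FP` (the grid has the constant length `3G + 1`). [cite: AroraBarak2009, §1.3] -/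
theorem iterate_gridStep_mem_FP (G : ℕ) (c q₀ : Polynomial ℕ) : ∀ k : ℕ, ((gridStep G c q₀)^[k]) ∈ FP
  | 0 => OracleCompose.id_mem_FP
  | k + 1 => by rw [Function.iterate_succ']; exact comp_mem_FP (gridStep_mem_FP G c q₀) (iterate_gridStep_mem_FP G c q₀ k)

section StepValues

variable (G : ℕ) (c q₀ : Polynomial ℕ) (cx : List Bool) (i : ℕ) (as : List (List Bool)) (b : ℚ × ℕ)

/-- A record that is not running is fixed. [folklore] -/
theorem gridStep_of_ne_nil {S : List Bool} (hS : S ≠ []) : gridStep G c q₀ (gRec cx i S as b) = gRec cx i S as b := by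
  rw [gridStep, iteFn_apply (b := false) (by simp [zS_gRec, isNilFn, hS])]
  rfl

/-- A running record with no answer left stops pending. [folklore] -/
theorem gridStep_nil : gridStep G c q₀ (gRec cx i [] [] b) = gRec cx i (true :: queryF G c q₀ (gRec cx i [] [] b)) [] b := by
  rw [gridStep, iteFn_apply (b := true) (by simp [isNilFn]), iteFn_apply (b := true) (by simp)]
  simp only [if_true, pendF, fanoutFn_apply, Function.comp_apply, zCtx_gRec, zI_gRec, zAS_gRec, zB_gRec]
  rfl

/-- The candidate of the current index, on a record with an answer available. [folklore] -/
theorem candF_gRec (a : List Bool) : candF G (gRec cx i [] (a :: as) b) = boolPair (ptF G (gRec cx i [] (a :: as) b)) (encodeNat (decodeNat a)) := by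
  simp [candF, canonF_eq_encodeNat_decodeNat]

end StepValues

/-- **The candidate of grid index `i` for the answer `a`**: the grid point and the value read by
`decodeNat` (the post-processing of `replay_searchRound`). [folklore] -/
def rres (G m PY : ℕ) (st : ℕ × ℚ × ℕ) (i : ℕ) (a : List Bool) : ℚ × ℕ := (roundPt G m PY st i, decodeNat a)

/-- **A running record with an answer available consumes it** (context `ctxEnc`, `P_Y > 0`): the new
best is the candidate at index `0`, else the selection `sel`. [cite: AaronsonArkhipovToC2013, proof of Thm. 4.3, eq. (4.15) (p. 177)] -/
theorem gridStep_cons (G : ℕ) (c q₀ : Polynomial ℕ) (inp : List Bool) (m : ℕ) (w : List Bool) {PY : ℕ} (hPY : 0 < PY)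
    (st : ℕ × ℚ × ℕ) (i : ℕ) (a : List Bool) (as : List (List Bool)) (b : ℚ × ℕ) :
    gridStep G c q₀ (gRec (ctxEnc inp m w PY st) i [] (a :: as) b) =
      gRec (ctxEnc inp m w PY st) (i + 1) [] as
        (if i = 0 then rres G m PY st i a else sel b (rres G m PY st i a)) := by
  set cx := ctxEnc inp m w PY st with hcx
  have hcand : candF G (gRec cx i [] (a :: as) b) = bEnc (rres G m PY st i a) := by
    rw [candF_gRec, hcx, ptF_gRec G inp m w hPY, bEnc, rres]
  rw [gridStep, iteFn_apply (b := true) (by simp [isNilFn]), iteFn_apply (b := false) (by simp)]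
  simp only [Bool.false_eq_true, if_false, consumeF, fanoutFn_apply, zCtx_gRec, zI_gRec, Function.comp_apply, zAS_gRec,
    ansTlF_ansEnc, addFn_boolPair, bitsToNat_encodeNat]
  rw [show bitsToNat [true] = 1 by simp [bitsToNat]]
  have hnb : newBestF G (gRec cx i [] (a :: as) b) = bEnc (if i = 0 then rres G m PY st i a else sel b (rres G m PY st i a)) := by
    rw [newBestF]
    by_cases hi : i = 0
    · rw [iteFn_apply (b := true) (by simp [isNilFn, hi, (by decide : encodeNat 0 = [])]), hcand, if_pos hi]
      rfl
    · have hne : encodeNat i ≠ [] := fun h => hi (by rw [← bitsToNat_encodeNat i, h]; rfl)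
      rw [iteFn_apply (b := false) (by simp [isNilFn, hne]), if_neg hi]
      have hk : (keyLtF ∘ fanoutFn (fanoutFn (sndF ∘ candF G) (sndF ∘ fstF ∘ candF G)) (fanoutFn (sndF ∘ zB) (sndF ∘ fstF ∘ zB)))
          (gRec cx i [] (a :: as) b) = [decide (keyW (rres G m PY st i a) < keyW b)] := by
        simp only [Function.comp_apply, fanoutFn_apply, hcand, zB_gRec, bEnc, sndF_boolPair, fstF_boolPair, sndF_qEnc]
        exact keyLtF_eq_keyW _ _
      rw [iteFn_apply hk, sel]
      by_cases hlt : keyW (rres G m PY st i a) < keyW b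
      · simp [hlt, hcand]
      · simp [hlt, zB_gRec]
  rw [hnb]
  rfl

/-! ### The iterates: an online fold of the grid values -/

/-- **The online fold**: consume the answers one at a time from index `i` and best `b` (index `0`
restarts the best). [folklore] -/
def gfold (G m PY : ℕ) (st : ℕ × ℚ × ℕ) : ℕ → (ℚ × ℕ) → List (List Bool) → ℚ × ℕ
  | _, b, [] => b
  | i, b, a :: as => gfold G m PY st (i + 1) (if i = 0 then rres G m PY st i a else sel b (rres G m PY st i a)) as

/-- **The iterates of `gridStep` while answers last** follow the online fold. [folklore] -/
theorem iterate_gridStep_gRec (G : ℕ) (c q₀ : Polynomial ℕ) (inp : List Bool) (m : ℕ) (w : List Bool) {PY : ℕ} (hPY : 0 < PY)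
    (st : ℕ × ℚ × ℕ) : ∀ (j i : ℕ) (as : List (List Bool)) (b : ℚ × ℕ), j ≤ as.length →
      (gridStep G c q₀)^[j] (gRec (ctxEnc inp m w PY st) i [] as b) =
        gRec (ctxEnc inp m w PY st) (i + j) [] (as.drop j) (gfold G m PY st i b (as.take j))
  | 0, i, as, b, _ => by simp [gfold]
  | j + 1, i, [], b, h => by simp at h
  | j + 1, i, a :: as, b, h => by
    rw [Function.iterate_succ_apply, gridStep_cons G c q₀ inp m w hPY,
      iterate_gridStep_gRec G c q₀ inp m w hPY st j (i + 1) as _ (by simpa using h)]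
    simp only [List.drop_succ_cons, List.take_succ_cons, gfold]
    congr 1
    omega

/-- A pending record is fixed by all further iterates. [folklore] -/
theorem iterate_gridStep_of_ne_nil (G : ℕ) (c q₀ : Polynomial ℕ) (cx : List Bool) (i : ℕ) {S : List Bool} (hS : S ≠ [])
    (as : List (List Bool)) (b : ℚ × ℕ) : ∀ j : ℕ, (gridStep G c q₀)^[j] (gRec cx i S as b) = gRec cx i S as b
  | 0 => rfl
  | j + 1 => by rw [Function.iterate_succ_apply, gridStep_of_ne_nil G c q₀ cx i as b hS, iterate_gridStep_of_ne_nil G c q₀ cx i hS as b j]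

/-- **The iterates of `gridStep` past the end of the transcript**: the answers are all consumed and the
record is pending at index `i + |as|`. [folklore] -/
theorem iterate_gridStep_pending (G : ℕ) (c q₀ : Polynomial ℕ) (inp : List Bool) (m : ℕ) (w : List Bool) {PY : ℕ} (hPY : 0 < PY)
    (st : ℕ × ℚ × ℕ) {j : ℕ} (i : ℕ) {as : List (List Bool)} (hj : as.length < j) (b : ℚ × ℕ) :
    (gridStep G c q₀)^[j] (gRec (ctxEnc inp m w PY st) i [] as b) =
      gRec (ctxEnc inp m w PY st) (i + as.length)
        (true :: queryF G c q₀ (gRec (ctxEnc inp m w PY st) (i + as.length) [] [] (gfold G m PY st i b as)))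
        [] (gfold G m PY st i b as) := by
  obtain ⟨d, rfl⟩ : ∃ d, j = d + 1 + as.length := ⟨j - as.length - 1, by omega⟩
  rw [Function.iterate_add_apply, iterate_gridStep_gRec G c q₀ inp m w hPY st as.length i as b le_rfl, List.drop_length,
    List.take_length, Function.iterate_succ_apply, gridStep_nil,
    iterate_gridStep_of_ne_nil G c q₀ _ _ (List.cons_ne_nil _ _)]

/-- The fold from a positive index is the `foldl` of the selection over the `zipWith` of the values. [folklore] -/
theorem gfold_succ_eq_foldl (G m PY : ℕ) (st : ℕ × ℚ × ℕ) : ∀ (i : ℕ) (b : ℚ × ℕ) (as : List (List Bool)),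
    gfold G m PY st (i + 1) b as = (List.zipWith (rres G m PY st) (List.range' (i + 1) as.length) as).foldl sel b
  | i, b, [] => rfl
  | i, b, a :: as => by
    rw [gfold, if_neg (Nat.succ_ne_zero i), List.length_cons, List.range'_succ, List.zipWith_cons_cons, List.foldl_cons,
      gfold_succ_eq_foldl G m PY st (i + 1) _ as]

/-- `map succ (range n)` is `range' 1 n`. [folklore] -/
theorem map_succ_range (n : ℕ) : (List.range n).map Nat.succ = List.range' 1 n := by
  rw [List.range'_eq_map_range]
  exact List.map_congr_left fun x _ => by omega

/-- **The online fold from index `0` is the `argmin` of `replay_searchRound`.** [cite: AaronsonArkhipovToC2013, proof of Thm. 4.3, eq. (4.15) (p. 177)] -/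
theorem gfold_eq_argminBy (G m PY : ℕ) (st : ℕ × ℚ × ℕ) (b : ℚ × ℕ) (a : List Bool) (as : List (List Bool)) :
    gfold G m PY st 0 b (a :: as) =
      argminBy keyW ((0 : ℚ), 0) (List.zipWith (rres G m PY st) (List.range (as.length + 1)) (a :: as)) := by
  rw [gfold, if_pos rfl, List.range_succ_eq_map, List.zipWith_cons_cons, argminBy, gfold_succ_eq_foldl, Nat.zero_add,
    map_succ_range]
  rfl

/-! ### One search round -/

/-- The status field of the rounds-loop state `⟨S, ⟨AS, ⟨FD, ST⟩⟩⟩`. [folklore] -/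
def rS : List Bool → List Bool := nthF 0
/-- The transcript field. [folklore] -/
def rAS : List Bool → List Bool := nthF 1
/-- The level-data field. [folklore] -/
def rFD : List Bool → List Bool := nthF 2
/-- The search-state field. [folklore] -/
def rST : List Bool → List Bool := sndPow 2

/-- On the rounds-loop record `⟨inp, ⟨counter, state⟩⟩`: **the initial grid record** of the round
(context from the input and the state, index `0`, running, the transcript, junk best). [folklore] -/
def gInitF : List Bool → List Bool :=
  fanoutFn (fanoutFn (nthF 0) (fanoutFn (rFD ∘ sndPow 1) (rST ∘ sndPow 1)))
    (fanoutFn (fun _ => []) (fanoutFn (fun _ => []) (fanoutFn (rAS ∘ sndPow 1) fun _ => junkB)))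

/-- `gInitF ∈ FP`. [cite: AroraBarak2009, §1.3] -/
theorem gInitF_mem_FP : gInitF ∈ FP :=
  fanoutFn_mem_FP (fanoutFn_mem_FP (nthF_mem_FP 0) (fanoutFn_mem_FP (comp_mem_FP (nthF_mem_FP 2) (sndPow_mem_FP 1))
    (comp_mem_FP (sndPow_mem_FP 2) (sndPow_mem_FP 1))))
    (fanoutFn_mem_FP (const_mem_FP _) (fanoutFn_mem_FP (const_mem_FP _) (fanoutFn_mem_FP (comp_mem_FP (nthF_mem_FP 1) (sndPow_mem_FP 1))
      (const_mem_FP _))))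

/-- Value of the initial grid record on an encoded running state. [folklore] -/
theorem gInitF_apply (inp cnt : List Bool) (S : List Bool) (as : List (List Bool)) (m : ℕ) (w : List Bool) (PY : ℕ) (st : ℕ × ℚ × ℕ) :
    gInitF (boolPair inp (boolPair cnt (stateEnc S as m w PY st))) = gRec (ctxEnc inp m w PY st) 0 [] as (0, 0) := by
  simp [gInitF, stateEnc, ctxEnc, gRec, rFD, rST, rAS, nthF, sndPow, junkB, (by decide : encodeNat 0 = [])]

/-- After the grid: **finish the round** — a pending grid record gives a pending state (status copied);
otherwise the new search state `(t + 1, best point, best value)`. [cite: AaronsonArkhipovToC2013, proof of Thm. 4.3, eq. (4.15) (p. 177)] -/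
def finishF : List Bool → List Bool :=
  iteFn (isNilFn ∘ zS ∘ sndF)
    (fanoutFn (fun _ => []) (fanoutFn (zAS ∘ sndF) (fanoutFn (rFD ∘ sndPow 1 ∘ fstF)
      (fanoutFn (addFn ∘ fanoutFn (nthF 0 ∘ rST ∘ sndPow 1 ∘ fstF) fun _ => [true]) (zB ∘ sndF)))))
    (fanoutFn (zS ∘ sndF) (fanoutFn (zAS ∘ sndF) (fanoutFn (rFD ∘ sndPow 1 ∘ fstF) (rST ∘ sndPow 1 ∘ fstF))))

/-- `finishF ∈ FP`. [cite: AroraBarak2009, §1.3] -/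
theorem finishF_mem_FP : finishF ∈ FP := by
  have hS : zS ∈ FP := proj_mem_FP.2.2.1
  have hAS : zAS ∈ FP := proj_mem_FP.2.2.2.1
  have hB : zB ∈ FP := proj_mem_FP.2.2.2.2.1
  have hFD : (rFD ∘ sndPow 1 ∘ fstF) ∈ FP := comp_mem_FP (nthF_mem_FP 2) (comp_mem_FP (sndPow_mem_FP 1) fstF_mem_FP)
  have hST : (rST ∘ sndPow 1 ∘ fstF) ∈ FP := comp_mem_FP (sndPow_mem_FP 2) (comp_mem_FP (sndPow_mem_FP 1) fstF_mem_FP)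
  exact iteFn_mem_FP (comp_mem_FP isNilFn_mem_FP (comp_mem_FP hS sndF_mem_FP))
    (fanoutFn_mem_FP (const_mem_FP _) (fanoutFn_mem_FP (comp_mem_FP hAS sndF_mem_FP) (fanoutFn_mem_FP hFD
      (fanoutFn_mem_FP (comp_mem_FP addFn_mem_FP (fanoutFn_mem_FP (comp_mem_FP (nthF_mem_FP 0) hST) (const_mem_FP _)))
        (comp_mem_FP hB sndF_mem_FP)))))
    (fanoutFn_mem_FP (comp_mem_FP hS sndF_mem_FP) (fanoutFn_mem_FP (comp_mem_FP hAS sndF_mem_FP) (fanoutFn_mem_FP hFD hST)))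

/-- **Finishing a pending grid**: the status is copied, the search state kept. [folklore] -/
theorem finishF_pending (inp cnt S : List Bool) (as : List (List Bool)) (m : ℕ) (w : List Bool) (PY : ℕ) (st : ℕ × ℚ × ℕ)
    (cx : List Bool) (i : ℕ) (q : List Bool) (as' : List (List Bool)) (b : ℚ × ℕ) :
    finishF (boolPair (boolPair inp (boolPair cnt (stateEnc S as m w PY st))) (gRec cx i (true :: q) as' b)) =
      stateEnc (true :: q) as' m w PY st := by
  rw [finishF, iteFn_apply (b := false) (by simp [isNilFn])]
  simp [stateEnc, rFD, rST, nthF, sndPow]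

/-- **Finishing a completed grid**: running, the leftover transcript, the new search state
`(t + 1, best point, best value)`. [folklore] -/
theorem finishF_done (inp cnt S : List Bool) (as : List (List Bool)) (m : ℕ) (w : List Bool) (PY : ℕ) (st : ℕ × ℚ × ℕ)
    (cx : List Bool) (i : ℕ) (as' : List (List Bool)) (b : ℚ × ℕ) :
    finishF (boolPair (boolPair inp (boolPair cnt (stateEnc S as m w PY st))) (gRec cx i [] as' b)) =
      stateEnc [] as' m w PY (st.1 + 1, b.1, b.2) := by
  rw [finishF, iteFn_apply (b := true) (by simp [isNilFn])]
  simp [stateEnc, stEnc, bEnc, rFD, rST, nthF, sndPow]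

/-- **One search round** on the rounds-loop record `⟨inp, ⟨counter, state⟩⟩`: the old state if it is
not running; `(t + 1, r, v)` if `v = 0`; otherwise the grid of `3G + 1` queries replayed and finished. [cite: AaronsonArkhipovToC2013, proof of Thm. 4.3, eqs. (4.9)–(4.15) (p. 177)] -/
def roundF (G : ℕ) (c q₀ : Polynomial ℕ) : List Bool → List Bool :=
  iteFn (isNilFn ∘ rS ∘ sndPow 1)
    (iteFn (isNilFn ∘ sndPow 1 ∘ rST ∘ sndPow 1)
      (fanoutFn (fun _ => []) (fanoutFn (rAS ∘ sndPow 1) (fanoutFn (rFD ∘ sndPow 1)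
        (fanoutFn (addFn ∘ fanoutFn (nthF 0 ∘ rST ∘ sndPow 1) fun _ => [true]) (sndPow 0 ∘ rST ∘ sndPow 1)))))
      (finishF ∘ fanoutFn id ((gridStep G c q₀)^[3 * G + 1] ∘ gInitF)))
    (sndPow 1)

/-- `roundF G c q₀ ∈ FP`. [cite: AroraBarak2009, §1.3] -/
theorem roundF_mem_FP (G : ℕ) (c q₀ : Polynomial ℕ) : roundF G c q₀ ∈ FP := by
  have hST : (rST ∘ sndPow 1) ∈ FP := comp_mem_FP (sndPow_mem_FP 2) (sndPow_mem_FP 1)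
  exact iteFn_mem_FP (comp_mem_FP isNilFn_mem_FP (comp_mem_FP (nthF_mem_FP 0) (sndPow_mem_FP 1)))
    (iteFn_mem_FP (comp_mem_FP isNilFn_mem_FP (comp_mem_FP (sndPow_mem_FP 1) hST))
      (fanoutFn_mem_FP (const_mem_FP _) (fanoutFn_mem_FP (comp_mem_FP (nthF_mem_FP 1) (sndPow_mem_FP 1))
        (fanoutFn_mem_FP (comp_mem_FP (nthF_mem_FP 2) (sndPow_mem_FP 1))
          (fanoutFn_mem_FP (comp_mem_FP addFn_mem_FP (fanoutFn_mem_FP (comp_mem_FP (nthF_mem_FP 0) hST) (const_mem_FP _)))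
            (comp_mem_FP (sndPow_mem_FP 0) hST)))))
      (comp_mem_FP finishF_mem_FP (fanoutFn_mem_FP OracleCompose.id_mem_FP
        (comp_mem_FP (iterate_gridStep_mem_FP G c q₀ _) gInitF_mem_FP))))
    (sndPow_mem_FP 1)

/-- **A state that is not running is fixed by the round.** [folklore] -/
theorem roundF_idle (G : ℕ) (c q₀ : Polynomial ℕ) (inp cnt : List Bool) {S : List Bool} (hS : S ≠ []) (rest : List Bool) :
    roundF G c q₀ (boolPair inp (boolPair cnt (boolPair S rest))) = boolPair S rest := by
  rw [roundF, iteFn_apply (b := false) (by simp [rS, isNilFn, nthF, hS])]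
  simp

/-- A running state with value `0` keeps its point and bumps the counter. [folklore] -/
theorem roundF_zero (G : ℕ) (c q₀ : Polynomial ℕ) (inp cnt : List Bool) (as : List (List Bool)) (m : ℕ) (w : List Bool) (PY : ℕ)
    (t : ℕ) (r : ℚ) : roundF G c q₀ (boolPair inp (boolPair cnt (stateEnc [] as m w PY (t, r, 0)))) = stateEnc [] as m w PY (t + 1, r, 0) := by
  rw [roundF, iteFn_apply (b := true) (by simp [rS, isNilFn, nthF, stateEnc]),
    iteFn_apply (b := true) (by simp [rST, isNilFn, sndPow, stateEnc, stEnc, (by decide : encodeNat 0 = [])])]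
  simp [stateEnc, stEnc, rAS, rFD, rST, nthF, sndPow, (by decide : encodeNat 0 = [])]

/-- A running state with a nonzero value runs the grid and finishes. [folklore] -/
theorem roundF_grid (G : ℕ) (c q₀ : Polynomial ℕ) (inp cnt : List Bool) (as : List (List Bool)) (m : ℕ) (w : List Bool) (PY : ℕ)
    (t : ℕ) (r : ℚ) {v : ℕ} (hv : v ≠ 0) :
    roundF G c q₀ (boolPair inp (boolPair cnt (stateEnc [] as m w PY (t, r, v)))) =
      finishF (boolPair (boolPair inp (boolPair cnt (stateEnc [] as m w PY (t, r, v))))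
        ((gridStep G c q₀)^[3 * G + 1] (gRec (ctxEnc inp m w PY (t, r, v)) 0 [] as (0, 0)))) := by
  have hne : encodeNat v ≠ [] := fun h => hv (by rw [← bitsToNat_encodeNat v, h]; rfl)
  rw [roundF, iteFn_apply (b := true) (by simp [rS, isNilFn, nthF, stateEnc]),
    iteFn_apply (b := false) (by simp [rST, isNilFn, sndPow, stateEnc, stEnc, hne])]
  simp only [Bool.false_eq_true, if_false, if_true, Function.comp_apply, fanoutFn_apply, id, gInitF_apply]

/-- The post-processing of `replay_searchRound` is `rres`. [folklore] -/
theorem rres_eq (G m PY : ℕ) (st : ℕ × ℚ × ℕ) : (fun (i : ℕ) (a : List Bool) => (roundPt G m PY st i, decodeNat a)) = rres G m PY st := rfl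

/-- **The round on a running state realises the replay of `searchRound`** (level of dimension `m + 1`,
`|w| = (m+1)²`, `P_Y > 0`, machine input `⟨u, A⟩`, queries made by the randomised maker
`randMaker G c q₀ u`): the new running state on `inr`, a pending state carrying the query on `inl`. [cite: AaronsonArkhipovToC2013, proof of Thm. 4.3, eqs. (4.9)–(4.15) (p. 177)] -/
theorem roundF_running (G : ℕ) (c q₀ : Polynomial ℕ) (u A cnt : List Bool) (m : ℕ) {w : List Bool}
    (hw : w.length = (m + 1) * (m + 1)) {PY : ℕ} (hPY : 0 < PY) (st : ℕ × ℚ × ℕ) (as : List (List Bool)) :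
    roundF G c q₀ (boolPair (boolPair u A) (boolPair cnt (stateEnc [] as m w PY st))) =
      match replay (searchRound (randMaker G c q₀ u) G (m + 1) (wmat (m + 1) w) PY st) as with
      | Sum.inr (st', as') => stateEnc [] as' m w PY st'
      | Sum.inl q => stateEnc (true :: q) [] m w PY st := by
  obtain ⟨t, r, v⟩ := st
  rw [replay_searchRound]
  by_cases hv : v = 0
  · subst hv
    rw [if_pos rfl, roundF_zero]
  · rw [if_neg hv, roundF_grid G c q₀ _ cnt as m w PY t r hv]
    by_cases hlen : 3 * G + 1 ≤ as.length
    · rw [if_pos hlen, iterate_gridStep_gRec G c q₀ _ m w hPY (t, r, v) (3 * G + 1) 0 as (0, 0) hlen, finishF_done]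
      obtain ⟨a, as₁, rfl⟩ : ∃ a as₁, as = a :: as₁ := by
        cases as with
        | nil => simp at hlen
        | cons a as₁ => exact ⟨a, as₁, rfl⟩
      have hl3 : 3 * G ≤ as₁.length := by simpa using hlen
      have htake : (as₁.take (3 * G)).length = 3 * G := by rw [List.length_take, min_eq_left hl3]
      dsimp only
      rw [rres_eq, List.take_succ_cons, gfold_eq_argminBy, htake]
    · rw [if_neg hlen, iterate_gridStep_pending G c q₀ _ m w hPY (t, r, v) 0 (not_le.1 hlen) (0, 0), finishF_pending,
        Nat.zero_add, queryF_gRec G c q₀ u A m hw hPY]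

end PerSearch

end Literature.Computability.QuantumComplexity

end
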